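import Literature.MathematicalPhysics.QuantumFieldTheory.Balaban1983to89.B1Sect3Statements

/-!
# `Balaban1983to89.B2Eq218Translation` — [Balaban1982Higgs2] (2.18)–(2.19) p. 560 and the kernel display p. 561:
the translation `A = A′ + aL⁻²C^{(0)}_{Λ₀}Q*B` (2.18) and its «small/large» split `A = B̃^{(1)} + A″` (2.19) —
DEFINITIONS WITH BODIES in matrix coordinates, and (2.19) PROVED as an exact identity under the printed support facts

statement-level skeleton of published theorems with citation tags; proofs where landed; nothing here is a claim about the Yang–Mills mass gap

CITATION HEADER.  T. Bałaban, *(Higgs)₂,₃ quantum fields in a finite volume. II. An upper bound*, Commun. Math. Phys.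
**86** (1982) 555–594, doi:10.1007/bf01214890 [Balaban1982Higgs2] (cell paper B2; PDF held
`paper:balaban1982-cmp86-higgs23-ii`, journal page = PDF page + 554; pp. 560–561 READ AS IMAGES on the ×2 renders
`run/shared/lean/pub/pub-balaban/b2b-balaban-ref1/pages/1982-cmp86-higgs23-II/1982-cmp86-higgs23-II-p006-x2.png`,
`…-p007-x2.png`).  Unit `lit-balaban-r02` gen 3 (reader/typer, B2 fold owner; HOME `run/shared/lean/pub/lit-balaban/`).
SKELETON row **B2.Eq2.18** ((2.18)–(2.19), status before this file: `absent (D-row)`); the row feeds B2.Eq2.42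
((2.20)–(2.42), whose members (2.20)–(2.21) `…B2Eq220CovDerivSplit` (p15) start from the split `B̃^{(1)} + A″` defined
here).  Part I objects cited by the print: the translation (I.3.10) = `B1Sect3Statements.transl310` (REUSED below, not
restated), the covariances `C^{(0)}`, `C^{(0)}_{Λ₀}` and `δC^{(0)}_{Λ₀}` of Chap. I.2 / Proposition I.2.3
([Balaban1982Higgs1] (2.35)–(2.36) p. 611: *"Putting δC^{(k)}_Λ(Ω,A) = C^{(k)}_Λ(Ω,A) − C^{(k)}(Ω,A), (2.35) we have
|δC^{(k)}_Λ(Ω,A;x,x′)| ≦ c₀exp(−δ₀(|x−x′| + dist(x,Λᶜ) + dist(x′,Λᶜ))), x, x′ ∈ Λ. (2.36)"*, typed in `B1.Prop23Literal`).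

WHAT IS PRINTED (verbatim, p. 560 [PDF 6]).  *"Now we will make a translation in the fields A analogous to the translation
(I.3.10) in the proof of the lower bound, only now it is connected with a conditional integral, the conditioning in the set
Λ₀ᶜ. Thus we make a translation  A = A′ + aL⁻²C^{(0)}_{Λ₀}Q*B, (2.18)  where C^{(0)}_{Λ₀} denotes the covariance with the
Dirichlet boundary conditions outside Λ₀ introduced in Chap. I.2. Its properties were described in Proposition I.2.3. In the
third section of this chapter we will prove a general result from which it follows that the field A′ is small on Λ₁, i.e.
|A′(x)| ≦ O(1)p(ε) for x ∈ Λ₁. Next we divide the field (2.18) into two components: one "small," with respect to which we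
will expand the action, and one "large" which will remain in all the expressions in the preceding form. To define this
division let us introduce a function θ₁ equal to 1 on Λ₂ and changing smoothly from 1 to 0 on a slice of thickness < M
surrounding Λ₂. We have
A = [(1 − θ₁)(A′ + aL⁻²C^{(0)}_{Λ₀}Q*B) + θ₁aL⁻²ζC^{(0)}Q*B] + θ₁(A′ + aL⁻²δC^{(0)}_{Λ₀}Q*B + aL⁻²(1 − ζ)C^{(0)}Q*Λ′₀B)
=: B̃^{(1)} + A″, (2.19)"*  and p. 561 [PDF 7]: *"where ζC^{(0)}Q* denotes an operator with the kernel
(ζC^{(0)}Q*)(x, y) = ζ(x, y)L^{−d} Σ_{x′∈B(y)} C^{(0)}(x, x′),  x ∈ T₁,  y ∈ T′₁,  and the function ζ is determined by the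
conditions: ζ(x, y) = 1 if |x − y| ≦ ½r(ε), ζ(x, y) = 0 if |x − y| > ½r(ε). A definition of the operator (1 − ζ)C^{(0)}Q*
should be clear. A″ is a small field and we can expand the action with respect to this field."*

DICTIONARY (matrix coordinates, the schematic style of `…B1GaussNorm331` / `…B2Sect3AGaussianStep`): a finite index type
`X` ↤ the components of unit-lattice vector fields on `T₁` (site × direction, or bonds), `Y` ↤ the components of the
block fields on `T′₁`; `blk : X → Y` ↤ the block map (`x ∈ B(y)` ⇔ `blk x = y`, componentwise); `w` ↤ `L^{−d}`, so that
`Q*` has the kernel `Q*(x, y) = L^{−d}·[x ∈ B(y)]` (`qstar`, read off the p. 561 display); `c` ↤ `aL⁻²`;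
`C` ↤ `C^{(0)}` and `CΛ` ↤ `C^{(0)}_{Λ₀}` as `Matrix X X ℝ`; `Λ₀ : Finset X`, `Λ₀' : Finset Y` ↤ Λ₀ and its block set Λ′₀
(`Λ′₀B` in (2.19) = the restriction `χ_{Λ′₀}·B`, `restrict`); `θ : X → ℝ` ↤ θ₁; `ζ : Matrix X Y ℝ` ↤ ζ(x, y) (for the
metric reading see `zetaOfDist`); `δC` ↤ δC^{(0)}_{Λ₀} = C^{(0)}_{Λ₀} − C^{(0)} ON Λ₀ × Λ₀ ((I.2.35)–(I.2.36): the kernel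
is introduced and estimated for `x, x′ ∈ Λ`; `deltaC` extends it by 0 — see THE READING below).

THE READING OF (2.19) (decided here, kernel-checked).  With `δC^{(0)}_{Λ₀}` the Λ₀ × Λ₀ kernel of (I.2.35)–(I.2.36),
`B̃^{(1)} + A″ − A = θ₁·aL⁻²·ζC^{(0)}Q*((1 − χ_{Λ′₀})B)` identically (`btilde_add_adprime_sub`), and this vanishes because on
the support of θ₁ (the M-slice around Λ₂ ⊂ Λ₁, at distance > r(ε) − M > ½r(ε) from Λ₀ᶜ by (2.8)) the cut-off ζ(x, ·) only
reaches blocks inside Λ′₀ — hypothesis `hζ` of `eq219`, derived from distances in `zeta_reach_of_dist`.  So (2.19) is an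
EXACT rewriting of (2.18) and the explicit `Λ′₀` in its last term is exactly what the identity requires (the ζ-term needs
none).  Were `δC^{(0)}_{Λ₀}` read instead as the full `T₁ × T₁` kernel `C^{(0)}_{Λ₀} − C^{(0)}`, the defect would be
`−θ₁aL⁻²(1 − ζ)C^{(0)}Q*((1 − χ_{Λ′₀})B)` (`defect_of_fullKernel`), not zero for a covariance of infinite range — recorded
as the reason for the reading, not as an erratum.

WHAT THIS MODULE PROVIDES.  Definitions with bodies: `qstar` (Q*), `transl218` ((2.18); `transl218_eq_transl310`: it IS
part I's `transl310` with `C^{(0)}_{Λ₀}`), `zetaCQ` (the p. 561 kernel, `zetaCQ_eq_hadamard`: = ζ ⊙ (C^{(0)}·Q*) entrywise,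
`zetaCQ_add_oneSub`: ζC^{(0)}Q* + (1 − ζ)C^{(0)}Q* = C^{(0)}Q*), `zetaOfDist` (ζ from the two printed conditions,
`zetaOfDist_eq_one` / `zetaOfDist_eq_zero`), `deltaC`, `restrict`, `btilde` (B̃^{(1)}), `adprime` (A″); theorems
`btilde_add_adprime_sub`, **`eq219`** (A = B̃^{(1)} + A″), `eq219_transl` (the same for the translated field (2.18)),
`adprime_eq_zero_of_theta` / `btilde_eq_of_theta` (off the slice: A″ = 0, B̃^{(1)} = A), `zeta_reach_of_dist`,
`defect_of_fullKernel`.  No `Prop`-valued fact, no `sorry`; axioms standard.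
-/

namespace Literature.MathematicalPhysics.QuantumFieldTheory.Balaban1983to89.B2Eq218Translation

open Finset Matrix

variable {X Y : Type*}

/-! ## The operators of (2.18) and of the p. 561 display -/

/-- The adjoint block averaging `Q*` as a kernel, read off the p. 561 display `(ζC^{(0)}Q*)(x,y) = ζ(x,y)L^{−d}Σ_{x′∈B(y)}
C^{(0)}(x,x′)`: `Q*(x′, y) = L^{−d}·[x′ ∈ B(y)]`, i.e. `(Q*B)(x′) = L^{−d}B(y)` for `x′ ∈ B(y)` (`w` ↤ `L^{−d}`, `blk x′ = y`
↤ `x′ ∈ B(y)`). [cite: Balaban1982Higgs2, (2.18)–(2.19) pp.560–561] -/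
def qstar [DecidableEq Y] (w : ℝ) (blk : X → Y) : Matrix X Y ℝ := fun x y => if blk x = y then w else 0

/-- `(Q*B)(x) = L^{−d}B(y)` for `x ∈ B(y)` — the kernel of `Q*` applied to a block field (p. 561 display).
[cite: Balaban1982Higgs2, (2.19) p.561] -/
theorem qstar_mulVec [Fintype Y] [DecidableEq Y] (w : ℝ) (blk : X → Y) (B : Y → ℝ) (x : X) :
    (qstar w blk *ᵥ B) x = w * B (blk x) := by
  simp [qstar, Matrix.mulVec, dotProduct, ite_mul, Finset.sum_ite_eq]

/-- `Q*B` as a function: `x ↦ L^{−d}B(y(x))` (p. 561 display). [cite: Balaban1982Higgs2, (2.19) p.561] -/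
theorem qstar_mulVec_eq [Fintype Y] [DecidableEq Y] (w : ℝ) (blk : X → Y) (B : Y → ℝ) :
    qstar w blk *ᵥ B = fun x => w * B (blk x) :=
  funext (qstar_mulVec w blk B)

/-- `(C·Q*)(x, y) = L^{−d} Σ_{x′ ∈ B(y)} C(x, x′)` — the un-cut-off kernel of the p. 561 display.
[cite: Balaban1982Higgs2, (2.19) pp.560–561] -/
theorem mul_qstar_apply [Fintype X] [DecidableEq Y] (C : Matrix X X ℝ) (w : ℝ) (blk : X → Y) (x : X) (y : Y) :
    (C * qstar w blk) x y = w * ∑ x' ∈ univ.filter (fun x' => blk x' = y), C x x' := by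
  simp only [Matrix.mul_apply, qstar, mul_ite, mul_zero, Finset.sum_ite, Finset.sum_const_zero, add_zero,
    Finset.mul_sum]
  exact Finset.sum_congr rfl fun _ _ => mul_comm _ _

/-- A kernel applied to the block-averaged field, as one sum over the fine components:
`(K Q*B)(x) = Σ_{x′} K(x, x′) L^{−d} B(y(x′))`. [cite: Balaban1982Higgs2, (2.18) p.560] -/
theorem mulVec_qstar_mulVec [Fintype X] [Fintype Y] [DecidableEq Y] (K : Matrix X X ℝ) (w : ℝ) (blk : X → Y)
    (B : Y → ℝ) (x : X) : (K *ᵥ (qstar w blk *ᵥ B)) x = ∑ x', K x x' * (w * B (blk x')) := by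
  rw [qstar_mulVec_eq]
  simp [Matrix.mulVec, dotProduct]

/-- **(2.18)** p. 560 [PDF 6], verbatim: *"A = A′ + aL⁻²C^{(0)}_{Λ₀}Q*B"* — the translated vector field as a function of
the new variable `A′` and the block field `B` (`c` ↤ `aL⁻²`, `CΛ` ↤ `C^{(0)}_{Λ₀}`, the covariance with Dirichlet boundary
conditions outside Λ₀ of Chap. I.2). [cite: Balaban1982Higgs2, (2.18) p.560] -/
def transl218 [Fintype X] [Fintype Y] [DecidableEq Y] (c w : ℝ) (CΛ : Matrix X X ℝ) (blk : X → Y)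
    (A' : X → ℝ) (B : Y → ℝ) : X → ℝ :=
  A' + c • (CΛ *ᵥ (qstar w blk *ᵥ B))

/-- (2.18) IS the part I translation (I.3.10) `B1Sect3Statements.transl310` (*"analogous to the translation (I.3.10)"*,
p. 560) with `C^{(0)}_{Λ₀}` in the place of `C^{(0)}`. [cite: Balaban1982Higgs2, (2.18) p.560] -/
theorem transl218_eq_transl310 [Fintype X] [Fintype Y] [DecidableEq Y] (c w : ℝ) (CΛ : Matrix X X ℝ)
    (blk : X → Y) (A' : X → ℝ) (B : Y → ℝ) :
    transl218 c w CΛ blk A' B = B1Sect3Statements.transl310 c CΛ.mulVecLin (qstar w blk).mulVecLin A' B := by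
  simp [transl218, B1Sect3Statements.transl310]

/-- (2.18) at a point: `A(x) = A′(x) + aL⁻² Σ_{x′} C^{(0)}_{Λ₀}(x, x′) L^{−d} B(y(x′))`. [cite: Balaban1982Higgs2, (2.18) p.560] -/
theorem transl218_apply [Fintype X] [Fintype Y] [DecidableEq Y] (c w : ℝ) (CΛ : Matrix X X ℝ) (blk : X → Y)
    (A' : X → ℝ) (B : Y → ℝ) (x : X) :
    transl218 c w CΛ blk A' B x = A' x + c * ∑ x', CΛ x x' * (w * B (blk x')) := by
  simp only [transl218, Pi.add_apply, Pi.smul_apply, smul_eq_mul, mulVec_qstar_mulVec]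

/-- The p. 561 display, verbatim: *"ζC^{(0)}Q* denotes an operator with the kernel (ζC^{(0)}Q*)(x, y) = ζ(x, y)L^{−d}
Σ_{x′∈B(y)} C^{(0)}(x, x′), x ∈ T₁, y ∈ T′₁"* — for an arbitrary weight `ζ` (so that `zetaCQ (1 − ζ) …` is the operator
`(1 − ζ)C^{(0)}Q*` whose *"definition … should be clear"*). [cite: Balaban1982Higgs2, (2.19) p.561] -/
def zetaCQ [Fintype X] [DecidableEq Y] (ζ : Matrix X Y ℝ) (C : Matrix X X ℝ) (w : ℝ) (blk : X → Y) :
    Matrix X Y ℝ :=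
  fun x y => ζ x y * (w * ∑ x' ∈ univ.filter (fun x' => blk x' = y), C x x')

/-- The p. 561 kernel is the entrywise (Hadamard) product `ζ ⊙ (C^{(0)}·Q*)`. [cite: Balaban1982Higgs2, (2.19) p.561] -/
theorem zetaCQ_eq_hadamard [Fintype X] [DecidableEq Y] (ζ : Matrix X Y ℝ) (C : Matrix X X ℝ) (w : ℝ)
    (blk : X → Y) : zetaCQ ζ C w blk = ζ ⊙ (C * qstar w blk) := by
  ext x y
  simp [zetaCQ, Matrix.hadamard, mul_qstar_apply]

/-- `ζC^{(0)}Q* + (1 − ζ)C^{(0)}Q* = C^{(0)}Q*`. [cite: Balaban1982Higgs2, (2.19) p.561] -/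
theorem zetaCQ_add_oneSub [Fintype X] [DecidableEq Y] (ζ : Matrix X Y ℝ) (C : Matrix X X ℝ) (w : ℝ)
    (blk : X → Y) : zetaCQ ζ C w blk + zetaCQ (fun x y => 1 - ζ x y) C w blk = C * qstar w blk := by
  ext x y
  simp only [Matrix.add_apply, zetaCQ, mul_qstar_apply]
  ring

/-- `(ζC^{(0)}Q* B)(x) = Σ_{x′} ζ(x, y(x′)) L^{−d} C^{(0)}(x, x′) B(y(x′))` — the kernel applied to a block field, as a
single sum over fine components. [cite: Balaban1982Higgs2, (2.19) p.561] -/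
theorem zetaCQ_mulVec [Fintype X] [Fintype Y] [DecidableEq Y] (ζ : Matrix X Y ℝ) (C : Matrix X X ℝ) (w : ℝ)
    (blk : X → Y) (B : Y → ℝ) (x : X) :
    (zetaCQ ζ C w blk *ᵥ B) x = ∑ x', ζ x (blk x') * (w * C x x') * B (blk x') := by
  have h : ∀ y : Y, zetaCQ ζ C w blk x y * B y =
      ∑ x' ∈ univ.filter (fun x' => blk x' = y), ζ x (blk x') * (w * C x x') * B (blk x') := by
    intro y
    unfold zetaCQ
    rw [Finset.mul_sum, Finset.mul_sum, Finset.sum_mul]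
    refine Finset.sum_congr rfl fun x' hx' => ?_
    rw [(Finset.mem_filter.1 hx').2]
  calc (zetaCQ ζ C w blk *ᵥ B) x = ∑ y, zetaCQ ζ C w blk x y * B y := rfl
    _ = ∑ y, ∑ x' ∈ univ.filter (fun x' => blk x' = y), ζ x (blk x') * (w * C x x') * B (blk x') :=
        Finset.sum_congr rfl fun y _ => h y
    _ = ∑ x', ζ x (blk x') * (w * C x x') * B (blk x') := Finset.sum_fiberwise univ blk _

/-- The cut-off `ζ` from its two printed conditions, p. 561: *"ζ(x, y) = 1 if |x − y| ≦ ½r(ε), ζ(x, y) = 0 if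
|x − y| > ½r(ε)"* (`dist x y` ↤ `|x − y|`, `r` ↤ `r(ε)`). [cite: Balaban1982Higgs2, (2.19) p.561] -/
noncomputable def zetaOfDist (dist : X → Y → ℝ) (r : ℝ) : Matrix X Y ℝ :=
  fun x y => if dist x y ≤ r / 2 then 1 else 0

/-- p. 561, first condition: *"ζ(x, y) = 1 if |x − y| ≦ ½r(ε)"*. [cite: Balaban1982Higgs2, (2.19) p.561] -/
theorem zetaOfDist_eq_one {dist : X → Y → ℝ} {r : ℝ} {x : X} {y : Y} (h : dist x y ≤ r / 2) :
    zetaOfDist dist r x y = 1 := by simp [zetaOfDist, h]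

/-- p. 561, second condition: *"ζ(x, y) = 0 if |x − y| > ½r(ε)"*. [cite: Balaban1982Higgs2, (2.19) p.561] -/
theorem zetaOfDist_eq_zero {dist : X → Y → ℝ} {r : ℝ} {x : X} {y : Y} (h : r / 2 < dist x y) :
    zetaOfDist dist r x y = 0 := by simp [zetaOfDist, not_le.2 h]

/-- `δC^{(0)}_{Λ₀}`, the kernel of [Balaban1982Higgs1] (2.35)–(2.36): *"δC^{(k)}_Λ = C^{(k)}_Λ − C^{(k)} (2.35) …
x, x′ ∈ Λ (2.36)"* — the difference of the two covariances as a kernel ON Λ₀ × Λ₀, extended by zero (THE READING of the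
module docstring). [cite: Balaban1982Higgs2, (2.19) p.560] -/
def deltaC [DecidableEq X] (Λ₀ : Finset X) (CΛ C : Matrix X X ℝ) : Matrix X X ℝ :=
  fun x x' => if x ∈ Λ₀ ∧ x' ∈ Λ₀ then CΛ x x' - C x x' else 0

/-- `Λ′₀B` in (2.19): the block field restricted to the block set Λ′₀ (characteristic function).
[cite: Balaban1982Higgs2, (2.19) p.560] -/
def restrict [DecidableEq Y] (Λ₀' : Finset Y) (B : Y → ℝ) : Y → ℝ := fun y => if y ∈ Λ₀' then B y else 0

/-- `(1 − χ_{Λ′₀})B`: the part of the block field outside Λ′₀, the complement of the `Λ′₀B` of (2.19).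
[cite: Balaban1982Higgs2, (2.19) p.560] -/
theorem sub_restrict_apply [DecidableEq Y] (Λ₀' : Finset Y) (B : Y → ℝ) (y : Y) :
    (B - restrict Λ₀' B) y = if y ∈ Λ₀' then 0 else B y := by
  by_cases hy : y ∈ Λ₀' <;> simp [restrict, hy]

/-- **B̃^{(1)}** of (2.19) p. 560, verbatim: *"[(1 − θ₁)(A′ + aL⁻²C^{(0)}_{Λ₀}Q*B) + θ₁aL⁻²ζC^{(0)}Q*B]"* — the «large»
component. [cite: Balaban1982Higgs2, (2.19) p.560] -/
def btilde [Fintype X] [Fintype Y] [DecidableEq Y] (c w : ℝ) (CΛ C : Matrix X X ℝ) (blk : X → Y) (θ : X → ℝ)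
    (ζ : Matrix X Y ℝ) (A' : X → ℝ) (B : Y → ℝ) : X → ℝ :=
  fun x => (1 - θ x) * (A' x + c * (CΛ *ᵥ (qstar w blk *ᵥ B)) x) + θ x * (c * (zetaCQ ζ C w blk *ᵥ B) x)

/-- **A″** of (2.19) p. 560, verbatim: *"θ₁(A′ + aL⁻²δC^{(0)}_{Λ₀}Q*B + aL⁻²(1 − ζ)C^{(0)}Q*Λ′₀B)"* — the «small» component,
with respect to which the action is expanded. [cite: Balaban1982Higgs2, (2.19) p.560] -/
def adprime [Fintype X] [Fintype Y] [DecidableEq X] [DecidableEq Y] (c w : ℝ) (Λ₀ : Finset X) (Λ₀' : Finset Y)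
    (CΛ C : Matrix X X ℝ) (blk : X → Y) (θ : X → ℝ) (ζ : Matrix X Y ℝ) (A' : X → ℝ) (B : Y → ℝ) : X → ℝ :=
  fun x => θ x * (A' x + c * (deltaC Λ₀ CΛ C *ᵥ (qstar w blk *ᵥ B)) x
    + c * (zetaCQ (fun x y => 1 - ζ x y) C w blk *ᵥ restrict Λ₀' B) x)

/-! ## (2.19) as an identity -/

section Identity

variable [Fintype X] [Fintype Y] [DecidableEq X] [DecidableEq Y]
  {c w : ℝ} {Λ₀ : Finset X} {Λ₀' : Finset Y} {CΛ C : Matrix X X ℝ} {blk : X → Y} {θ : X → ℝ} {ζ : Matrix X Y ℝ}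

/-- Off the slice (θ₁(x) = 0): A″(x) = 0. [cite: Balaban1982Higgs2, (2.19) p.560] -/
theorem adprime_eq_zero_of_theta {A' : X → ℝ} {B : Y → ℝ} {x : X} (hx : θ x = 0) :
    adprime c w Λ₀ Λ₀' CΛ C blk θ ζ A' B x = 0 := by
  simp [adprime, hx]

omit [DecidableEq X] in
/-- Off the slice (θ₁(x) = 0): B̃^{(1)}(x) = A(x) (the whole translated field (2.18)).
[cite: Balaban1982Higgs2, (2.19) p.560] -/
theorem btilde_eq_of_theta {A' : X → ℝ} {B : Y → ℝ} {x : X} (hx : θ x = 0) :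
    btilde c w CΛ C blk θ ζ A' B x = transl218 c w CΛ blk A' B x := by
  simp [btilde, transl218, hx]

/-- The bookkeeping behind (2.19): for EVERY `θ₁, ζ, B`, if `C^{(0)}_{Λ₀}` has Dirichlet support (`hCΛ`: its kernel vanishes
unless both arguments lie in Λ₀), Λ₀ is the union of the blocks of Λ′₀ (`hblk`) and θ₁ is supported in Λ₀ (`hθ`), then
`B̃^{(1)} + A″ − A = θ₁·aL⁻²·ζC^{(0)}Q*((1 − χ_{Λ′₀})B)` pointwise. [cite: Balaban1982Higgs2, (2.19) p.560] -/
theorem btilde_add_adprime_sub (A' : X → ℝ) (B : Y → ℝ)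
    (hCΛ : ∀ x x', CΛ x x' ≠ 0 → x ∈ Λ₀ ∧ x' ∈ Λ₀) (hblk : ∀ x', x' ∈ Λ₀ ↔ blk x' ∈ Λ₀')
    (hθ : ∀ x, θ x ≠ 0 → x ∈ Λ₀) (x : X) :
    btilde c w CΛ C blk θ ζ A' B x + adprime c w Λ₀ Λ₀' CΛ C blk θ ζ A' B x - transl218 c w CΛ blk A' B x =
      θ x * (c * (zetaCQ ζ C w blk *ᵥ (B - restrict Λ₀' B)) x) := by
  by_cases hθx : θ x = 0
  · simp [btilde, adprime, transl218, hθx]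
  have hxΛ : x ∈ Λ₀ := hθ x hθx
  have hD : (deltaC Λ₀ CΛ C *ᵥ (qstar w blk *ᵥ B)) x =
      ∑ x', (if x' ∈ Λ₀ then CΛ x x' - C x x' else 0) * (w * B (blk x')) := by
    rw [mulVec_qstar_mulVec]
    simp only [deltaC, hxΛ, true_and]
  simp only [btilde, adprime, transl218, Pi.add_apply, Pi.smul_apply, smul_eq_mul, mulVec_qstar_mulVec, hD,
    zetaCQ_mulVec, restrict, sub_restrict_apply]
  have key : ∀ x', θ x * (c * (ζ x (blk x') * (w * C x x') * B (blk x')))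
      + θ x * (c * ((if x' ∈ Λ₀ then CΛ x x' - C x x' else 0) * (w * B (blk x')))
        + c * ((1 - ζ x (blk x')) * (w * C x x') * (if blk x' ∈ Λ₀' then B (blk x') else 0)))
      - θ x * (c * (CΛ x x' * (w * B (blk x'))))
      = θ x * (c * (ζ x (blk x') * (w * C x x') * (if blk x' ∈ Λ₀' then 0 else B (blk x')))) := by
    intro x'
    by_cases hx' : x' ∈ Λ₀
    · have hy : blk x' ∈ Λ₀' := (hblk x').1 hx'
      simp only [hx', hy, if_true]
      ring
    · have hy : blk x' ∉ Λ₀' := fun h => hx' ((hblk x').2 h)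
      have hC0 : CΛ x x' = 0 := by
        by_contra h
        exact hx' (hCΛ x x' h).2
      simp only [hx', hy, if_false, hC0]
      ring
  calc (1 - θ x) * (A' x + c * ∑ x', CΛ x x' * (w * B (blk x')))
        + θ x * (c * ∑ x', ζ x (blk x') * (w * C x x') * B (blk x'))
        + θ x * (A' x + c * ∑ x', (if x' ∈ Λ₀ then CΛ x x' - C x x' else 0) * (w * B (blk x'))
          + c * ∑ x', (1 - ζ x (blk x')) * (w * C x x') * (if blk x' ∈ Λ₀' then B (blk x') else 0))
        - (A' x + c * ∑ x', CΛ x x' * (w * B (blk x')))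
        = ∑ x', (θ x * (c * (ζ x (blk x') * (w * C x x') * B (blk x')))
            + θ x * (c * ((if x' ∈ Λ₀ then CΛ x x' - C x x' else 0) * (w * B (blk x')))
              + c * ((1 - ζ x (blk x')) * (w * C x x') * (if blk x' ∈ Λ₀' then B (blk x') else 0)))
            - θ x * (c * (CΛ x x' * (w * B (blk x'))))) := by
          simp only [Finset.sum_add_distrib, Finset.sum_sub_distrib, ← Finset.mul_sum]
          ring
    _ = ∑ x', θ x * (c * (ζ x (blk x') * (w * C x x') * (if blk x' ∈ Λ₀' then 0 else B (blk x')))) :=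
          Finset.sum_congr rfl fun x' _ => key x'
    _ = θ x * (c * ∑ x', ζ x (blk x') * (w * C x x') * (if blk x' ∈ Λ₀' then 0 else B (blk x'))) := by
          rw [Finset.mul_sum, Finset.mul_sum]

/-- **(2.19)** p. 560 [PDF 6]: `A = B̃^{(1)} + A″` — the split is an EXACT rewriting of the translated field (2.18), under
the printed support facts: `C^{(0)}_{Λ₀}` has Dirichlet boundary conditions outside Λ₀ (`hCΛ`), Λ₀ is the union of the
blocks `B(y), y ∈ Λ′₀` (`hblk`), θ₁ is supported inside Λ₀ (`hθ`; print: in the M-slice around Λ₂ ⊂ Λ₁ ⊂ Λ₀), and on that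
support the cut-off ζ(x, ·) (range ½r(ε)) only reaches blocks of Λ′₀ (`hζ`; from distances: `zeta_reach_of_dist`).
[cite: Balaban1982Higgs2, (2.19) p.560] -/
theorem eq219 (A' : X → ℝ) (B : Y → ℝ)
    (hCΛ : ∀ x x', CΛ x x' ≠ 0 → x ∈ Λ₀ ∧ x' ∈ Λ₀) (hblk : ∀ x', x' ∈ Λ₀ ↔ blk x' ∈ Λ₀')
    (hθ : ∀ x, θ x ≠ 0 → x ∈ Λ₀) (hζ : ∀ x y, θ x ≠ 0 → ζ x y ≠ 0 → y ∈ Λ₀') :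
    transl218 c w CΛ blk A' B = btilde c w CΛ C blk θ ζ A' B + adprime c w Λ₀ Λ₀' CΛ C blk θ ζ A' B := by
  funext x
  have h := btilde_add_adprime_sub (c := c) (w := w) (C := C) (ζ := ζ) (Λ₀' := Λ₀') A' B hCΛ hblk hθ x
  have hzero : θ x * (c * (zetaCQ ζ C w blk *ᵥ (B - restrict Λ₀' B)) x) = 0 := by
    by_cases hθx : θ x = 0
    · simp [hθx]
    rw [zetaCQ_mulVec]
    have hs : ∑ x', ζ x (blk x') * (w * C x x') * (B - restrict Λ₀' B) (blk x') = 0 := by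
      refine Finset.sum_eq_zero fun x' _ => ?_
      by_cases hz : ζ x (blk x') = 0
      · simp [hz]
      have hy : blk x' ∈ Λ₀' := hζ x (blk x') hθx hz
      simp [restrict, hy]
    rw [hs]
    ring
  rw [hzero] at h
  simp only [Pi.add_apply]
  linarith

/-- (2.19) for the original integration variable: with `A′ := A − aL⁻²C^{(0)}_{Λ₀}Q*B` (the inverse of (2.18)),
`A = B̃^{(1)} + A″`. [cite: Balaban1982Higgs2, (2.18)–(2.19) p.560] -/
theorem eq219_transl (A : X → ℝ) (B : Y → ℝ)
    (hCΛ : ∀ x x', CΛ x x' ≠ 0 → x ∈ Λ₀ ∧ x' ∈ Λ₀) (hblk : ∀ x', x' ∈ Λ₀ ↔ blk x' ∈ Λ₀')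
    (hθ : ∀ x, θ x ≠ 0 → x ∈ Λ₀) (hζ : ∀ x y, θ x ≠ 0 → ζ x y ≠ 0 → y ∈ Λ₀') :
    A = btilde c w CΛ C blk θ ζ (A - c • (CΛ *ᵥ (qstar w blk *ᵥ B))) B
      + adprime c w Λ₀ Λ₀' CΛ C blk θ ζ (A - c • (CΛ *ᵥ (qstar w blk *ᵥ B))) B := by
  have h := eq219 (c := c) (w := w) (CΛ := CΛ) (C := C) (blk := blk) (θ := θ) (ζ := ζ) (Λ₀ := Λ₀) (Λ₀' := Λ₀')
    (A - c • (CΛ *ᵥ (qstar w blk *ᵥ B))) B hCΛ hblk hθ hζ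
  rw [← h]
  simp [transl218]

omit [DecidableEq X] in
/-- The reading is forced: were `δC^{(0)}_{Λ₀}` the FULL `T₁ × T₁` kernel `C^{(0)}_{Λ₀} − C^{(0)}` (no restriction to
Λ₀ × Λ₀), then under the same support facts `B̃^{(1)} + A″ − A = −θ₁·aL⁻²·(1 − ζ)C^{(0)}Q*((1 − χ_{Λ′₀})B)`, which does not
vanish for a covariance `C^{(0)}` of unbounded range. [cite: Balaban1982Higgs2, (2.19) p.560] -/
theorem defect_of_fullKernel (A' : X → ℝ) (B : Y → ℝ)
    (hζ : ∀ x y, θ x ≠ 0 → ζ x y ≠ 0 → y ∈ Λ₀') (x : X) :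
    btilde c w CΛ C blk θ ζ A' B x
      + θ x * (A' x + c * ((CΛ - C) *ᵥ (qstar w blk *ᵥ B)) x
        + c * (zetaCQ (fun x y => 1 - ζ x y) C w blk *ᵥ restrict Λ₀' B) x)
      - transl218 c w CΛ blk A' B x =
      -(θ x * (c * (zetaCQ (fun x y => 1 - ζ x y) C w blk *ᵥ (B - restrict Λ₀' B)) x)) := by
  by_cases hθx : θ x = 0
  · simp [btilde, transl218, hθx]
  have hD : ((CΛ - C) *ᵥ (qstar w blk *ᵥ B)) x = ∑ x', (CΛ x x' - C x x') * (w * B (blk x')) := by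
    rw [mulVec_qstar_mulVec]
    simp only [Matrix.sub_apply]
  simp only [btilde, transl218, Pi.add_apply, Pi.smul_apply, smul_eq_mul, mulVec_qstar_mulVec, hD, zetaCQ_mulVec,
    restrict, sub_restrict_apply]
  have key : ∀ x', θ x * (c * (ζ x (blk x') * (w * C x x') * B (blk x')))
      + θ x * (c * ((CΛ x x' - C x x') * (w * B (blk x')))
        + c * ((1 - ζ x (blk x')) * (w * C x x') * (if blk x' ∈ Λ₀' then B (blk x') else 0)))
      - θ x * (c * (CΛ x x' * (w * B (blk x'))))
      = -(θ x * (c * ((1 - ζ x (blk x')) * (w * C x x') * (if blk x' ∈ Λ₀' then 0 else B (blk x'))))) := by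
    intro x'
    by_cases hy : blk x' ∈ Λ₀'
    · simp only [hy, if_true]
      ring
    · have hz : ζ x (blk x') = 0 := by
        by_contra h
        exact hy (hζ x (blk x') hθx h)
      simp only [hy, if_false, hz]
      ring
  calc (1 - θ x) * (A' x + c * ∑ x', CΛ x x' * (w * B (blk x')))
        + θ x * (c * ∑ x', ζ x (blk x') * (w * C x x') * B (blk x'))
        + θ x * (A' x + c * ∑ x', (CΛ x x' - C x x') * (w * B (blk x'))
          + c * ∑ x', (1 - ζ x (blk x')) * (w * C x x') * (if blk x' ∈ Λ₀' then B (blk x') else 0))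
        - (A' x + c * ∑ x', CΛ x x' * (w * B (blk x')))
        = ∑ x', (θ x * (c * (ζ x (blk x') * (w * C x x') * B (blk x')))
            + θ x * (c * ((CΛ x x' - C x x') * (w * B (blk x')))
              + c * ((1 - ζ x (blk x')) * (w * C x x') * (if blk x' ∈ Λ₀' then B (blk x') else 0)))
            - θ x * (c * (CΛ x x' * (w * B (blk x'))))) := by
          simp only [Finset.sum_add_distrib, Finset.sum_sub_distrib, ← Finset.mul_sum]
          ring
    _ = ∑ x', -(θ x * (c * ((1 - ζ x (blk x')) * (w * C x x')
          * (if blk x' ∈ Λ₀' then 0 else B (blk x'))))) :=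
          Finset.sum_congr rfl fun x' _ => key x'
    _ = -(θ x * (c * ∑ x', (1 - ζ x (blk x')) * (w * C x x')
          * (if blk x' ∈ Λ₀' then 0 else B (blk x')))) := by
          rw [Finset.mul_sum, Finset.mul_sum, ← Finset.sum_neg_distrib]

end Identity

/-- The hypothesis `hζ` of `eq219` from the printed geometry: if ζ is the cut-off of range ½r(ε) (`zetaOfDist`) and every
point of the support of θ₁ lies at distance > ½r(ε) from every block outside Λ′₀ (print: supp θ₁ ⊂ the M-slice around
Λ₂, and Λ₂ ⊂ Λ₁ lies at distance > r(ε) from Λ₀ᶜ by (2.8), r(ε) − M > ½r(ε)), then on supp θ₁ the kernel ζ(x, ·) only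
reaches Λ′₀. [cite: Balaban1982Higgs2, (2.19) pp.560–561] -/
theorem zeta_reach_of_dist {dist : X → Y → ℝ} {r : ℝ} {θ : X → ℝ} {Λ₀' : Finset Y}
    (hfar : ∀ x y, θ x ≠ 0 → y ∉ Λ₀' → r / 2 < dist x y) :
    ∀ x y, θ x ≠ 0 → zetaOfDist dist r x y ≠ 0 → y ∈ Λ₀' := by
  intro x y hx hz
  by_contra hy
  exact hz (zetaOfDist_eq_zero (hfar x y hx hy))

end Literature.MathematicalPhysics.QuantumFieldTheory.Balaban1983to89.B2Eq218Translation
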